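import Summits.PneNP.PneNP.Theorems.ConvexRankGatesConvexGateBlindExactLiftingTriangleVanishing

/-!
# Triangle instance — the two-line lemma

Support file for crux `ConvexGateBlind` (stmt-PneNP-10680), open stub `stub_exactLifting`; prover seat 0, session 36,
memo ANALYSIS15 §2. Continuation of `…TriangleVanishing` (third of four files proving regrouping rigidity of the cheap corner of
`M_t` unconditionally). With `ψ_β = Σ_L β_L [L mono]` vanishing on the nondegenerate rows where `K = {p,q}` (third block `T`)
is bichromatic (`VanOn β K`), the previous file left only the coefficients of `K` and of the two fans `{p r}`, `{q r}`
(`r ∈ T`, equal in pairs) undetermined. Here: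
* `VanOn.sum_third` — `Σ_{r ∈ T} β_{sr} = 0` for each end `s` (the value of `ψ_β` at ONE row with `K` bichromatic, after the
  other coefficients are gone): so the solution space is `t`-dimensional;
* `VanOn.self_of_two`, `VanOn.fan_of_two`, **`VanOn.eq_zero_of_two`** — if `ψ_β` vanishes wherever `K₁` is bichromatic AND
  wherever `K₂ ≠ K₁` is bichromatic, then `β = 0` (case analysis on the relative position of the two lines, using only the
  four coefficient facts). Registered form `triangle_two_line_vanishing` (self-contained vocabulary).
-/

set_option linter.dupNamespace false -- `Summit.PneNP.PneNP.…`: summit = sub-problem (D-0017)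

namespace Summit.PneNP.PneNP.Theorems.XorDoor.TriLine

open Finset

noncomputable section

variable {t : ℕ}

namespace VanOn

variable {β : Line t → ℝ} {K : Line t}

/-! ## The value of `ψ_β` at one row: the fan sums vanish -/

/-- the fan of lines from an end `s` of `K` into the third block -/
def fan (K : Line t) (s : Vtx t) : Finset (Line t) := univ.image fun k : Fin t => vline s (tb K, k)

/-- membership in a fan -/
lemma mem_fan {K L : Line t} {s : Vtx t} : L ∈ fan K s ↔ ∃ k : Fin t, L = vline s (tb K, k) := by
  unfold fan; simp only [mem_image, mem_univ, true_and]; exact ⟨fun ⟨k, hk⟩ => ⟨k, hk.symm⟩, fun ⟨k, hk⟩ => ⟨k, hk.symm⟩⟩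

/-- the fan map is injective -/
lemma fan_injective {K : Line t} {s : Vtx t} (hs : onL s K) :
    Function.Injective fun k : Fin t => vline s ((tb K, k) : Vtx t) := by
  intro k k' h
  have hsk : s.1 ≠ ((tb K, k) : Vtx t).1 := fst_ne_tb_of_onL hs
  have hsk' : s.1 ≠ ((tb K, k') : Vtx t).1 := fst_ne_tb_of_onL hs
  have : onL ((tb K, k) : Vtx t) (vline s (tb K, k')) := by
    have h0 := onL_vline_right hsk
    simp only at h
    rwa [h] at h0
  rw [onL_vline_iff hsk'] at this
  rcases this with h' | h'
  · exact absurd (congrArg Prod.fst h').symm hsk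
  · exact (Prod.mk.inj h').2

/-- **`Σ_{r ∈ T} β_{sr} = 0`** for each end `s` of `K`: the value of `ψ_β` at a single row with `K` bichromatic, after the
previous lemmas have killed every other coefficient. -/
theorem sum_third (hV : VanOn β K) (ht : 4 ≤ t) {s : Vtx t} (hs : onL s K) :
    ∑ k : Fin t, β (vline s (tb K, k)) = 0 := by
  classical
  -- it suffices to treat `s = e1 K` (the `e2 K` fan has the same coefficients)
  suffices h : ∑ k : Fin t, β (vline (e1 K) (tb K, k)) = 0 by
    rcases hs with rfl | rfl
    · exact h
    · rw [← h]; exact sum_congr rfl fun k _ => (third hV ht rfl).symm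
  -- a row with `K` bichromatic
  obtain ⟨x, hR, hK1, hK2⟩ := exists_base2 ht K (not_onL_of_fst_eq_tb (rfl : ((tb K, (e1 K).2) : Vtx t).1 = tb K)) true
  have hKb : ¬ lmono x K := by rw [not_lmono_iff_col, hK1, hK2.1]; decide
  have h0 : lcomb β x = 0 := hV x (mu_ne_zero_of_robust hR) hKb
  unfold lcomb at h0
  -- restrict the sum to `{K} ∪ fan (e1 K) ∪ fan (e2 K)`
  have hzero : ∀ L, L ∉ ({K} ∪ fan K (e1 K) ∪ fan K (e2 K) : Finset (Line t)) → β L * mInd x L = 0 := by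
    intro L hL
    simp only [mem_union, mem_singleton, not_or, mem_fan, not_exists] at hL
    obtain ⟨⟨hLK, hf1⟩, hf2⟩ := hL
    rw [mul_eq_zero]; left
    rcases classify K L with ⟨h1, h2⟩ | h | ⟨s', r, hs', hrK, hrs, hrT, hL⟩ | ⟨s', r, hs', hrT, hL⟩
    · exact avoid hV ht h1 h2
    · exact absurd h hLK
    · rw [hL]; exact shared hV ht hs' hrK hrs hrT
    · exfalso
      have hr : r = ((tb K, r.2) : Vtx t) := by rw [← hrT]
      rcases hs' with h | h
      · exact hf1 r.2 (by rw [hL, h, ← hr])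
      · exact hf2 r.2 (by rw [hL, h, ← hr])
  rw [← sum_subset (subset_univ _) (fun L _ hL => hzero L hL)] at h0
  -- the three parts are pairwise disjoint
  have hT1 : ∀ k : Fin t, (e1 K).1 ≠ ((tb K, k) : Vtx t).1 := fun k => (tb_ne_e1_fst K).symm
  have hT2 : ∀ k : Fin t, (e2 K).1 ≠ ((tb K, k) : Vtx t).1 := fun k => (tb_ne_e2_fst K).symm
  have hKf1 : K ∉ fan K (e1 K) := by
    rw [mem_fan]; rintro ⟨k, hk⟩
    have : onL (e2 K) (vline (e1 K) (tb K, k)) := hk ▸ Or.inr rfl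
    rw [onL_vline_iff (hT1 k)] at this
    rcases this with h | h
    · exact e1_ne_e2 K h.symm
    · exact tb_ne_e2_fst K (congrArg Prod.fst h).symm
  have hKf2 : K ∉ fan K (e2 K) := by
    rw [mem_fan]; rintro ⟨k, hk⟩
    have : onL (e1 K) (vline (e2 K) (tb K, k)) := hk ▸ Or.inl rfl
    rw [onL_vline_iff (hT2 k)] at this
    rcases this with h | h
    · exact e1_ne_e2 K h
    · exact tb_ne_e1_fst K (congrArg Prod.fst h).symm
  have hdisj12 : Disjoint (fan K (e1 K)) (fan K (e2 K)) := by
    rw [disjoint_left]; intro L hL1 hL2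
    rw [mem_fan] at hL1 hL2
    obtain ⟨k, hk⟩ := hL1; obtain ⟨k', hk'⟩ := hL2
    have : onL (e1 K) (vline (e2 K) (tb K, k')) := hk' ▸ hk ▸ onL_vline_left (hT1 k)
    rw [onL_vline_iff (hT2 k')] at this
    rcases this with h | h
    · exact e1_ne_e2 K h
    · exact tb_ne_e1_fst K (congrArg Prod.fst h).symm
  have hdisj : Disjoint ({K} ∪ fan K (e1 K)) (fan K (e2 K)) := by
    rw [disjoint_union_left]; exact ⟨disjoint_singleton_left.2 hKf2, hdisj12⟩
  rw [sum_union hdisj, sum_union (disjoint_singleton_left.2 hKf1), sum_singleton] at h0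
  have hmK : mInd x K = 0 := by unfold mInd; rw [if_neg hKb]
  rw [hmK, mul_zero, zero_add] at h0
  unfold fan at h0
  rw [sum_image fun k _ k' _ h => fan_injective (Or.inl rfl) h,
    sum_image fun k _ k' _ h => fan_injective (Or.inr rfl) h, ← sum_add_distrib] at h0
  rw [← h0]
  refine sum_congr rfl fun k _ => ?_
  -- `β_{pr} m_{pr} + β_{qr} m_{qr} = β_{pr}` since `β_{qr} = β_{pr}` and exactly one of the two lines is monochromatic
  rw [← third hV ht rfl]
  have hm : mInd x (vline (e1 K) (tb K, k)) + mInd x (vline (e2 K) (tb K, k)) = 1 := by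
    have key1 : lmono x (vline (e1 K) (tb K, k)) ↔ true = col x (tb K) k := by
      rw [lmono_iff_col]
      rcases ends_vline (hT1 k) with ⟨a1, a2⟩ | ⟨a1, a2⟩ <;> rw [a1, a2, hK1]
      exact eq_comm
    have key2 : lmono x (vline (e2 K) (tb K, k)) ↔ false = col x (tb K) k := by
      rw [lmono_iff_col]
      rcases ends_vline (hT2 k) with ⟨a1, a2⟩ | ⟨a1, a2⟩ <;> rw [a1, a2, hK2.1]
      exact eq_comm
    simp only [mInd, key1, key2]
    cases col x (tb K) k <;> simp
  linear_combination -(β (vline (e1 K) (tb K, k))) * hm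

/-! ## The two-line lemma -/

/-- the coefficient of `K₁` itself vanishes as soon as a second line `K₂ ≠ K₁` also annihilates -/
theorem self_of_two {K₁ K₂ : Line t} (h₁ : VanOn β K₁) (h₂ : VanOn β K₂) (ht : 4 ≤ t) (hne : K₁ ≠ K₂) : β K₁ = 0 := by
  classical
  rcases classify K₂ K₁ with ⟨h1, h2⟩ | h | ⟨s, r, hs, hrK, hrs, hrT, hL⟩ | ⟨s, r, hs, hrT, hL⟩
  · exact avoid h₂ ht h1 h2
  · exact absurd h hne
  · rw [hL]; exact shared h₂ ht hs hrK hrs hrT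
  · -- `K₁ = vline s r` shares `s` with `K₂`, its other end `r` in the third block of `K₂`: use the fan sum of `K₂` at `s`
    have hsum := sum_third h₂ ht hs
    have hsr : s.1 ≠ r.1 := by rw [hrT]; exact fst_ne_tb_of_onL hs
    have hr : r = ((tb K₂, r.2) : Vtx t) := by rw [← hrT]
    rw [Fintype.sum_eq_single r.2] at hsum
    · rw [hL, hr]; exact hsum
    · intro k hk
      -- the line `vline s (tb K₂, k)` shares `s` with `K₁ = vline s r`; its other end is in `r`'s block and is not `r`
      set r' : Vtx t := (tb K₂, k) with hr'
      have hr'r : r' ≠ r := fun e => hk (by rw [hr] at e; exact (Prod.mk.inj e).2)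
      have hsr' : s.1 ≠ r'.1 := fun e => hsr (e.trans hrT.symm)
      have hsK₁ : onL s K₁ := by rw [hL]; exact onL_vline_left hsr
      have hrK₁ : onL r K₁ := by rw [hL]; exact onL_vline_right hsr
      have hr'K₁ : ¬ onL r' K₁ := by
        intro h'
        rw [hL, onL_vline_iff hsr] at h'
        rcases h' with e | e
        · exact hsr' (congrArg Prod.fst e).symm
        · exact hr'r e
      have hr'T : r'.1 ≠ tb K₁ := by
        intro e
        have : r.1 = tb K₁ := hrT.trans e
        exact fst_ne_tb_of_onL hrK₁ this
      exact shared h₁ ht hsK₁ hr'K₁ (Ne.symm hsr') hr'T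

/-- the ends of a line written as `vline` -/
lemma onL_iff_of_eq_vline {K : Line t} {s q u : Vtx t} (hK : K = vline s q) (hsq : s.1 ≠ q.1) :
    onL u K ↔ u = s ∨ u = q := by
  rw [hK, onL_vline_iff hsq]

/-- the fan coefficients of `K₁` vanish too -/
theorem fan_of_two {K₁ K₂ : Line t} (h₁ : VanOn β K₁) (h₂ : VanOn β K₂) (ht : 4 ≤ t) (hne : K₁ ≠ K₂) {r : Vtx t}
    (hr : r.1 = tb K₁) : β (vline (e1 K₁) r) = 0 := by
  classical
  have hK₂ : β K₂ = 0 := self_of_two h₂ h₁ ht hne.symm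
  have hpr : (e1 K₁).1 ≠ r.1 := by rw [hr]; exact (tb_ne_e1_fst K₁).symm
  have hqr : (e2 K₁).1 ≠ r.1 := by rw [hr]; exact (tb_ne_e2_fst K₁).symm
  have hrK₁ : ¬ onL r K₁ := not_onL_of_fst_eq_tb hr
  have hre1 : r ≠ e1 K₁ := fun e => hrK₁ (e ▸ Or.inl rfl)
  have hre2 : r ≠ e2 K₁ := fun e => hrK₁ (e ▸ Or.inr rfl)
  rcases classify K₂ (vline (e1 K₁) r) with ⟨h1, h2⟩ | h | ⟨s, r₂, hs, hr₂K, hr₂s, hr₂T, hL⟩ | ⟨s, r₂, hs, hr₂T, hL⟩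
  · exact avoid h₂ ht h1 h2
  · rw [h]; exact hK₂
  · rw [hL]; exact shared h₂ ht hs hr₂K hr₂s hr₂T
  · -- `vline (e1 K₁) r = vline s r₂` with `s` an end of `K₂` and `r₂` in the third block of `K₂`
    rw [third h₁ ht hr]
    have hsr₂ : s.1 ≠ r₂.1 := by rw [hr₂T]; exact fst_ne_tb_of_onL hs
    have hends : ∀ u, (u = e1 K₁ ∨ u = r) ↔ (u = s ∨ u = r₂) := by
      intro u; rw [← onL_vline_iff hpr, ← onL_vline_iff hsr₂, hL]
    -- the other end `q₂` of `K₂`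
    obtain ⟨q₂, hq₂K, hq₂s, hK₂eq⟩ := exists_other_end hs
    have hsq₂ : s.1 ≠ q₂.1 := fst_ne_fst_of_onL hs hq₂K hq₂s.symm
    have honK₂ : ∀ u, onL u K₂ ↔ u = s ∨ u = q₂ := fun u => onL_iff_of_eq_vline hK₂eq hsq₂
    rcases (hends (e1 K₁)).1 (Or.inl rfl) with he | he
    · -- Case A: `e1 K₁ = s`, hence `r = r₂`; then `vline (e2 K₁) r` avoids the ends of `K₂`
      have hrr : r = r₂ := by
        rcases (hends r).1 (Or.inr rfl) with h' | h'
        · exact absurd (h'.trans he.symm) hre1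
        · exact h'
      have key : ∀ u, onL u K₂ → ¬ onL u (vline (e2 K₁) r) := by
        intro u hu hu'
        rw [honK₂] at hu
        rw [onL_vline_iff hqr] at hu'
        rcases hu with rfl | rfl
        · rcases hu' with e | e
          · exact e1_ne_e2 K₁ (he.trans e)
          · exact hre1 (e.symm.trans he.symm)
        · rcases hu' with e | e
          · apply hne
            rw [hK₂eq, ← he, e, vline_e1_e2]
          · apply fst_ne_tb_of_onL hq₂K
            rw [e, hrr, hr₂T]
      exact avoid h₂ ht (key _ (Or.inl rfl)) (key _ (Or.inr rfl))
    · -- Case B: `e1 K₁ = r₂`, hence `r = s`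
      have hrs : r = s := by
        rcases (hends r).1 (Or.inr rfl) with h' | h'
        · exact h'
        · exact absurd (h'.trans he.symm) hre1
      by_cases hq₂e : q₂ = e2 K₁
      · -- then `K₂ = vline (e2 K₁) r`
        have : vline (e2 K₁) r = K₂ := by
          rw [hK₂eq, hq₂e, ← hrs, vline_comm hqr]
        rw [this]; exact hK₂
      · -- else `shared` for `K₂` at the end `s = r` with other vertex `e2 K₁`
        have h2K₂ : ¬ onL (e2 K₁) K₂ := by
          rw [honK₂]
          rintro (e | e)
          · exact hre2 (hrs.trans e.symm)
          · exact hq₂e e.symm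
        have h2s : (e2 K₁).1 ≠ s.1 := by rw [← hrs]; exact hqr
        have h2T : (e2 K₁).1 ≠ tb K₂ := by
          rw [← hr₂T, ← he]; exact (ne_of_lt (e1_fst_lt_e2_fst K₁)).symm
        have h0 := shared h₂ ht hs h2K₂ h2s h2T
        rwa [← hrs, ← vline_comm hqr] at h0

/-- **The two-line lemma.** If `ψ_β` vanishes wherever `K₁` is bichromatic and wherever `K₂ ≠ K₁` is bichromatic
(nondegenerate rows, `t ≥ 4`), then `β = 0`. -/
theorem eq_zero_of_two {K₁ K₂ : Line t} (h₁ : VanOn β K₁) (h₂ : VanOn β K₂) (ht : 4 ≤ t) (hne : K₁ ≠ K₂) (L : Line t) :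
    β L = 0 := by
  rcases classify K₁ L with ⟨h1, h2⟩ | h | ⟨s, r, hs, hrK, hrs, hrT, hL⟩ | ⟨s, r, hs, hrT, hL⟩
  · exact avoid h₁ ht h1 h2
  · rw [h]; exact self_of_two h₁ h₂ ht hne
  · rw [hL]; exact shared h₁ ht hs hrK hrs hrT
  · rw [hL]
    rcases hs with rfl | rfl
    · exact fan_of_two h₁ h₂ ht hne hrT
    · rw [← third h₁ ht hrT]; exact fan_of_two h₁ h₂ ht hne hrT

end VanOn

/-- **The two-line vanishing lemma for the triangle instance** (registered sub-goal `triangle_two_line_vanishing` of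
stmt-PneNP-10680, verbatim signature, self-contained vocabulary): for `t ≥ 4`, if a real combination `Σ_L β_L [L mono_x]` of
the `3t²` line patterns (lines `(Fin t × Fin t) ⊕ (Fin t × Fin t) ⊕ (Fin t × Fin t)`, rows = three `2`-colourings of `Fin t`)
vanishes at every row that is two-coloured on every block and under which `K₁` is bichromatic, and likewise for a second line
`K₂ ≠ K₁`, then `β = 0`. -/
theorem triangle_two_line_vanishing : ∀ (t : ℕ), 4 ≤ t → ∀ (β : (Fin t × Fin t) ⊕ (Fin t × Fin t) ⊕ (Fin t × Fin t) → ℝ)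
    (K₁ K₂ : (Fin t × Fin t) ⊕ (Fin t × Fin t) ⊕ (Fin t × Fin t)), K₁ ≠ K₂ → (∀ K ∈ [K₁, K₂], ∀ x : (Fin t → Bool) ×
    (Fin t → Bool) × (Fin t → Bool), ((∃ a a', x.1 a ≠ x.1 a') ∧ (∃ b b', x.2.1 b ≠ x.2.1 b') ∧ (∃ d d', x.2.2 d ≠
    x.2.2 d')) → ¬ Sum.elim (fun ab : Fin t × Fin t => x.1 ab.1 = x.2.1 ab.2) (Sum.elim (fun ad : Fin t × Fin t => x.1
    ad.1 = x.2.2 ad.2) (fun bd : Fin t × Fin t => x.2.1 bd.1 = x.2.2 bd.2)) K → ∑ L, β L * Sum.elim (fun ab : Fin t ×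
    Fin t => if x.1 ab.1 = x.2.1 ab.2 then (1 : ℝ) else 0) (Sum.elim (fun ad : Fin t × Fin t => if x.1 ad.1 = x.2.2
    ad.2 then (1 : ℝ) else 0) (fun bd : Fin t × Fin t => if x.2.1 bd.1 = x.2.2 bd.2 then (1 : ℝ) else 0)) L = 0) →
    ∀ L, β L = 0 := by
  intro t ht β K₁ K₂ hne hvan L
  have hV : ∀ K ∈ [K₁, K₂], VanOn β K := by
    intro K hK x hx hKb
    have h := hvan K hK x ((mu_ne_zero_iff_two_coloured x).1 hx) hKb
    unfold lcomb
    rw [← h]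
    exact sum_congr rfl fun L' _ => by rw [mInd_eq_elim]
  exact VanOn.eq_zero_of_two (hV K₁ (by simp)) (hV K₂ (by simp)) ht hne L

end

end Summit.PneNP.PneNP.Theorems.XorDoor.TriLine
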